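import Literature.Geometry.Lorentzian.KerrSchildSliceMetricSqrt
import Literature.Analysis.Calculus.MatrixFieldCLM
import HarnessLib

/-!
# The coefficient operators of the first-order symmetric hyperbolic form of the wave equation
# on a generalised Kerr–Schild background (family `gr`; infrastructure for the discharge of the
# named fact `KerrSchild.waveCauchyProblem`)

For a generalised Kerr–Schild background `B` on `ℝ⁴` (`g⁻¹ = G = η⁻¹ − φ ℓ♯ ⊗ ℓ♯`,
`KerrSchild.Background`) write `a = −G⁰⁰ = 1 + φ` (`invLapseSq`), `βᵏ = G^{0k}/a` (`shift`),
`h^{jk} = G^{jk} + a βʲ βᵏ` (`sliceInvMetric`; `KerrSchildLapseShift.lean`) and `E = h^{1/2}`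
(`sliceSqrt`; `KerrSchildSliceMetricSqrt.lean`). For a solution of the divergence-form wave equation
`□_G u = ∑_μ ∂_μ(G^{μν} ∂_ν u) = 0` the variables `V = (q⃗, q₀, u)`, `q_k = ∂_k u`,
`q₀ = ∂_t u − βᵏ ∂_k u`, solve the `3 + 1` first-order system (John, *PDE*, Ch. 5 §3, in the
lapse–shift form dictated by the fact that only `dt`, not `∂_t`, is uniformly timelike on a
Kerr–Schild background; see the module docstring of `KerrSchildLapseShift.lean`)

  `A⁰ ∂_t V = Aᵏ ∂_k V + B V`,  `A⁰ = diag(h, a, 1)`,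

  `h ∂_t q⃗ = h ∇q₀ + βᵏ h ∂_k q⃗ + h (∂β) q⃗`,
  `a ∂_t q₀ = a βᵏ ∂_k q₀ + h^{jk} ∂_j q_k + e⁰ q₀ + eᵏ q_k`,
  `∂_t u = q₀ + βᵏ q_k`,

with `Aᵏ` symmetric and `A⁰` symmetric positive definite, `e⁰ = ∑_μ ∂_μ G^{μ0}`,
`eᵏ = ∑_μ ∂_μ G^{μk} + e⁰ βᵏ − a (∂_t βᵏ − βʲ ∂_j βᵏ)`. With `S = diag(E, √a, 1)` (`S² = A⁰`) the
variables `W = S V` solve a system of Friedrichs' form (Friedrichs 1954, §1; the tree's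
`Literature.Analysis.PDE.foOp`)

  `∂_t W = 𝔄ᵏ ∂_k W + 𝔅 W`,  `𝔄ᵏ = S⁻¹ Aᵏ S⁻¹` symmetric,
  `𝔅 = S⁻¹ B S⁻¹ − S (∂_t S⁻¹) − ∑_k 𝔄ᵏ (∂_k S) S⁻¹`.

This file defines these coefficients as fields of endomorphisms of
`RVec = EuclideanSpace ℝ (Fin 3 ⊕ Fin 2)` over `ℝ⁴` (block matrices through
`Matrix.fromBlocks`, operators through `Matrix.toEuclideanCLM`) and proves their pointwise
properties: smoothness (`contDiff_sOp`, …, `contDiff_frakAOp`, `contDiff_frakBOp`), the algebra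
`S S⁻¹ = S⁻¹ S = 1`, `S S = A⁰` (`sOp_sInvOp_apply`, `sInvOp_sOp_apply`, `sOp_sOp_apply`), the
symmetry of `𝔄ᵏ` for the Euclidean inner product (`inner_frakAOp_comm`), the components of
`A⁰ w`, `Aᵏ w`, `B w` (`a0Op_apply_inl`, …), and the values on the flat region
(`frakAOp_of_eventuallyEq`, `frakBOp_of_eventuallyEq`: where `φ` vanishes near `x`,
`𝔄ᵏ(x)` and `𝔅(x)` are the constant Minkowski coefficients). The derivation of the system from
the wave equation and back is in the sequel files.

Everything is proved; no named fact and no `sorry` is introduced.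

## References

* F. John, *Partial differential equations*, 4th ed., Springer 1982, Ch. 5, §3, (3.2)–(3.4)
  (reduction of a second-order hyperbolic equation to a symmetric hyperbolic system). [John1982]
* K. O. Friedrichs, *Symmetric hyperbolic linear differential equations*, Comm. Pure Appl. Math.
  7 (1954) 345–392, §1. [Friedrichs1954]
* S. Alinhac, *Hyperbolic partial differential equations*, Springer 2009, §7.6 (symmetrisation
  and the energy method). [AlinhacHPDE2009]
-/

noncomputable section

open Set Filter
open scoped ContDiff Topology RealInnerProductSpace

namespace Literature.Geometry.Lorentzian

namespace KerrSchild

open Literature.Analysis.Calculus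

/-- The index type of the reduced variables `W = (w⃗, w₀, u)`: a spatial block `Fin 3` and the
block `Fin 2` of the two scalars `(w₀, u)`. [cite: John1982, Ch. 5 §3] -/
abbrev RIdx : Type := Fin 3 ⊕ Fin 2

/-- The value space `ℝ³ ⊕ ℝ²` of the reduced first-order system, with its Euclidean inner product.
[cite: John1982, Ch. 5 §3] -/
abbrev RVec : Type := EuclideanSpace ℝ RIdx

/-- Shorthand for Mathlib's `Matrix.toEuclideanCLM` over `ℝ`. -/
local notation "toOp" => Matrix.toEuclideanCLM (𝕜 := ℝ)

namespace Background

variable (B : Background)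

/-! ### The scalar lower-order coefficients -/

/-- The spatial derivatives of the shift, `∂_j βᵐ`. [cite: ChoquetbruhatCotsakis2002, §2 (2.1)] -/
def dShift (x : E4) (j m : Fin 3) : ℝ := fderiv ℝ (fun y ↦ B.shift y m) x (E4.basisVector j.succ)

/-- The time derivative of the shift, `∂_t βᵐ`. [cite: ChoquetbruhatCotsakis2002, §2 (2.1)] -/
def dtShift (x : E4) (m : Fin 3) : ℝ := fderiv ℝ (fun y ↦ B.shift y m) x (E4.basisVector 0)

/-- The divergence rows of the inverse metric, `∑_μ ∂_μ G^{μν}` (the first-order part of the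
divergence-form operator `∑_μ ∂_μ (G^{μν} ∂_ν u) = G^{μν} ∂_μ∂_ν u + (∑_μ ∂_μ G^{μν}) ∂_ν u`).
[cite: John1982, Ch. 5 §3] -/
def divInvMetric (x : E4) (ν : Fin 4) : ℝ :=
  ∑ μ, fderiv ℝ (fun y ↦ B.inverseMetric y μ ν) x (E4.basisVector μ)

/-- The coefficient `eᵏ = ∑_μ ∂_μ G^{μk} + (∑_μ ∂_μ G^{μ0}) βᵏ − a (∂_t βᵏ − βʲ ∂_j βᵏ)` of `q_k` in
the `q₀`-equation of the `3 + 1` first-order form of `□_G u = 0`. [cite: John1982, Ch. 5 §3] -/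
def lowCoeff (x : E4) (k : Fin 3) : ℝ :=
  B.divInvMetric x k.succ + B.divInvMetric x 0 * B.shift x k -
    B.invLapseSq x * (B.dtShift x k - ∑ j, B.shift x j * B.dShift x j k)

/-- `x ↦ ∂_v f (x)` is smooth for a smooth scalar field `f` and a fixed vector `v`. [folklore] -/
theorem contDiff_fderiv_apply_const {f : E4 → ℝ} (hf : ContDiff ℝ ∞ f) (v : E4) :
    ContDiff ℝ ∞ fun x ↦ fderiv ℝ f x v :=
  (hf.fderiv_right (m := ∞) le_rfl).clm_apply contDiff_const

/-- `∂_j βᵐ` is smooth. [cite: ChoquetbruhatCotsakis2002, §2] -/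
theorem contDiff_dShift (j m : Fin 3) : ContDiff ℝ ∞ fun x ↦ B.dShift x j m :=
  contDiff_fderiv_apply_const (B.contDiff_shift m) _

/-- `∂_t βᵐ` is smooth. [cite: ChoquetbruhatCotsakis2002, §2] -/
theorem contDiff_dtShift (m : Fin 3) : ContDiff ℝ ∞ fun x ↦ B.dtShift x m :=
  contDiff_fderiv_apply_const (B.contDiff_shift m) _

/-- `∑_μ ∂_μ G^{μν}` is smooth. [cite: John1982, Ch. 5 §3] -/
theorem contDiff_divInvMetric (ν : Fin 4) : ContDiff ℝ ∞ fun x ↦ B.divInvMetric x ν :=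
  ContDiff.sum fun μ _ ↦ contDiff_fderiv_apply_const (B.contDiff_inverseMetric μ ν) _

/-- `eᵏ` is smooth. [cite: John1982, Ch. 5 §3] -/
theorem contDiff_lowCoeff (k : Fin 3) : ContDiff ℝ ∞ fun x ↦ B.lowCoeff x k :=
  ((B.contDiff_divInvMetric k.succ).add ((B.contDiff_divInvMetric 0).mul (B.contDiff_shift k))).sub
    (B.contDiff_invLapseSq.mul ((B.contDiff_dtShift k).sub
      (ContDiff.sum fun j _ ↦ (B.contDiff_shift j).mul (B.contDiff_dShift j k))))

/-! ### The `3 × 3` blocks -/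

/-- The inverse slice metric as a `3 × 3` matrix. [cite: ChoquetbruhatCotsakis2002, §2 (2.1)] -/
def hMat (x : E4) : Matrix (Fin 3) (Fin 3) ℝ := Matrix.of fun j k ↦ B.sliceInvMetric x j k

/-- `E = h^{1/2}` as a `3 × 3` matrix. [cite: John1982, Ch. 5 §3] -/
def eMat (x : E4) : Matrix (Fin 3) (Fin 3) ℝ := Matrix.of fun j k ↦ B.sliceSqrt x j k

/-- `E⁻¹` as a `3 × 3` matrix. [cite: John1982, Ch. 5 §3] -/
def eInvMat (x : E4) : Matrix (Fin 3) (Fin 3) ℝ := Matrix.of fun j k ↦ B.sliceSqrtInv x j k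

/-- Entries of `hMat`. [cite: ChoquetbruhatCotsakis2002, §2 (2.1)] -/
@[simp] theorem hMat_apply (x : E4) (j k : Fin 3) : B.hMat x j k = B.sliceInvMetric x j k := rfl
/-- Entries of `eMat`. [cite: John1982, Ch. 5 §3] -/
@[simp] theorem eMat_apply (x : E4) (j k : Fin 3) : B.eMat x j k = B.sliceSqrt x j k := rfl
/-- Entries of `eInvMat`. [cite: John1982, Ch. 5 §3] -/
@[simp] theorem eInvMat_apply (x : E4) (j k : Fin 3) : B.eInvMat x j k = B.sliceSqrtInv x j k := rfl

/-- `E E⁻¹ = 1`. [cite: John1982, Ch. 5 §3] -/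
theorem eMat_mul_eInvMat (x : E4) : B.eMat x * B.eInvMat x = 1 :=
  Matrix.ext fun j l ↦ by
    rw [Matrix.mul_apply, Matrix.one_apply]; exact B.sum_sliceSqrt_mul_sliceSqrtInv x j l

/-- `E⁻¹ E = 1`. [cite: John1982, Ch. 5 §3] -/
theorem eInvMat_mul_eMat (x : E4) : B.eInvMat x * B.eMat x = 1 :=
  Matrix.ext fun j l ↦ by
    rw [Matrix.mul_apply, Matrix.one_apply]; exact B.sum_sliceSqrtInv_mul_sliceSqrt x j l

/-- `E E = h`. [cite: John1982, Ch. 5 §3] -/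
theorem eMat_mul_eMat (x : E4) : B.eMat x * B.eMat x = B.hMat x :=
  Matrix.ext fun j l ↦ by rw [Matrix.mul_apply]; exact B.sum_sliceSqrt_mul_sliceSqrt x j l

/-- `h` is symmetric. [cite: ChoquetbruhatCotsakis2002, §2 (2.1)] -/
theorem isSymm_hMat (x : E4) : (B.hMat x).IsSymm :=
  Matrix.IsSymm.ext fun j k ↦ B.sliceInvMetric_symm x k j

/-- `E` is symmetric. [cite: John1982, Ch. 5 §3] -/
theorem isSymm_eMat (x : E4) : (B.eMat x).IsSymm :=
  Matrix.IsSymm.ext fun j k ↦ B.sliceSqrt_symm x k j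

/-- `E⁻¹` is symmetric. [cite: John1982, Ch. 5 §3] -/
theorem isSymm_eInvMat (x : E4) : (B.eInvMat x).IsSymm :=
  Matrix.IsSymm.ext fun j k ↦ B.sliceSqrtInv_symm x k j

/-! ### The block matrices `S`, `S⁻¹`, `A⁰`, `Aᵏ`, `B` -/

/-- `S = diag(E, √a, 1)`, the symmetriser (`S² = A⁰`). [cite: John1982, Ch. 5 §3] -/
def sMat (x : E4) : Matrix RIdx RIdx ℝ :=
  Matrix.fromBlocks (B.eMat x) 0 0 !![B.invLapse x, 0; 0, 1]

/-- `S⁻¹ = diag(E⁻¹, 1/√a, 1)`. [cite: John1982, Ch. 5 §3] -/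
def sInvMat (x : E4) : Matrix RIdx RIdx ℝ :=
  Matrix.fromBlocks (B.eInvMat x) 0 0 !![(B.invLapse x)⁻¹, 0; 0, 1]

/-- `A⁰ = diag(h, a, 1)`, the (positive definite) coefficient of `∂_t` of the `3 + 1` first-order
form. [cite: John1982, Ch. 5 §3] -/
def a0Mat (x : E4) : Matrix RIdx RIdx ℝ :=
  Matrix.fromBlocks (B.hMat x) 0 0 !![B.invLapseSq x, 0; 0, 1]

/-- `Aᵏ`, the symmetric coefficient of `∂_k` of the `3 + 1` first-order form: spatial block
`βᵏ h`, couplings `h^{ik}` between `q_i` and `q₀`, entry `a βᵏ` for `q₀`, nothing for `u`.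
[cite: John1982, Ch. 5 §3] -/
def akMat (k : Fin 3) (x : E4) : Matrix RIdx RIdx ℝ :=
  Matrix.fromBlocks (B.shift x k • B.hMat x)
    (Matrix.of fun i r ↦ if r = 0 then B.sliceInvMetric x i k else 0)
    (Matrix.of fun r j ↦ if r = 0 then B.sliceInvMetric x k j else 0)
    !![B.invLapseSq x * B.shift x k, 0; 0, 0]

/-- `B`, the order-zero coefficient of the `3 + 1` first-order form: `h (∂β)` on `q⃗`, the row
`(eᵏ, e⁰, 0)` of the `q₀`-equation, and the row `(βᵏ, 1, 0)` of `∂_t u = q₀ + βᵏ q_k`.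
[cite: John1982, Ch. 5 §3] -/
def bMat (x : E4) : Matrix RIdx RIdx ℝ :=
  Matrix.fromBlocks (Matrix.of fun i m ↦ ∑ j, B.sliceInvMetric x i j * B.dShift x j m) 0
    (Matrix.of fun r j ↦ if r = 0 then B.lowCoeff x j else B.shift x j)
    !![B.divInvMetric x 0, 0; 1, 0]

/-- `S S⁻¹ = 1`. [cite: John1982, Ch. 5 §3] -/
theorem sMat_mul_sInvMat (x : E4) : B.sMat x * B.sInvMat x = 1 := by
  have hr : B.invLapse x ≠ 0 := (B.invLapse_pos x).ne'
  rw [sMat, sInvMat, Matrix.fromBlocks_multiply, B.eMat_mul_eInvMat]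
  simp only [Matrix.zero_mul, Matrix.mul_zero, add_zero, zero_add, Matrix.mul_fin_two,
    mul_inv_cancel₀ hr]
  norm_num [Matrix.fromBlocks_one, ← Matrix.one_fin_two]

/-- `S⁻¹ S = 1`. [cite: John1982, Ch. 5 §3] -/
theorem sInvMat_mul_sMat (x : E4) : B.sInvMat x * B.sMat x = 1 := by
  have hr : B.invLapse x ≠ 0 := (B.invLapse_pos x).ne'
  rw [sMat, sInvMat, Matrix.fromBlocks_multiply, B.eInvMat_mul_eMat]
  simp only [Matrix.zero_mul, Matrix.mul_zero, add_zero, zero_add, Matrix.mul_fin_two,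
    inv_mul_cancel₀ hr]
  norm_num [Matrix.fromBlocks_one, ← Matrix.one_fin_two]

/-- `S S = A⁰`. [cite: John1982, Ch. 5 §3] -/
theorem sMat_mul_sMat (x : E4) : B.sMat x * B.sMat x = B.a0Mat x := by
  rw [sMat, a0Mat, Matrix.fromBlocks_multiply, B.eMat_mul_eMat]
  simp only [Matrix.zero_mul, Matrix.mul_zero, add_zero, zero_add, Matrix.mul_fin_two,
    B.invLapse_mul_self]
  norm_num

/-- `S` is symmetric. [cite: John1982, Ch. 5 §3] -/
theorem isSymm_sMat (x : E4) : (B.sMat x).IsSymm :=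
  Matrix.IsSymm.fromBlocks (B.isSymm_eMat x) (by simp)
    (Matrix.IsSymm.ext fun i j ↦ by fin_cases i <;> fin_cases j <;> rfl)

/-- `S⁻¹` is symmetric. [cite: John1982, Ch. 5 §3] -/
theorem isSymm_sInvMat (x : E4) : (B.sInvMat x).IsSymm :=
  Matrix.IsSymm.fromBlocks (B.isSymm_eInvMat x) (by simp)
    (Matrix.IsSymm.ext fun i j ↦ by fin_cases i <;> fin_cases j <;> rfl)

/-- **`Aᵏ` is symmetric** (the structural point of the reduction). [cite: John1982, Ch. 5 §3] -/
theorem isSymm_akMat (k : Fin 3) (x : E4) : (B.akMat k x).IsSymm := by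
  refine Matrix.IsSymm.fromBlocks ((B.isSymm_hMat x).smul _) ?_
    (Matrix.IsSymm.ext fun i j ↦ by fin_cases i <;> fin_cases j <;> rfl)
  ext r i
  simp only [Matrix.transpose_apply, Matrix.of_apply, B.sliceInvMetric_symm x i k]

/-! ### The operator fields -/

/-- `S` as a field of endomorphisms of `RVec`. [cite: John1982, Ch. 5 §3] -/
def sOp (x : E4) : RVec →L[ℝ] RVec := toOp (B.sMat x)

/-- `S⁻¹` as a field of endomorphisms of `RVec`. [cite: John1982, Ch. 5 §3] -/
def sInvOp (x : E4) : RVec →L[ℝ] RVec := toOp (B.sInvMat x)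

/-- `A⁰` as a field of endomorphisms of `RVec`. [cite: John1982, Ch. 5 §3] -/
def a0Op (x : E4) : RVec →L[ℝ] RVec := toOp (B.a0Mat x)

/-- `Aᵏ` as a field of endomorphisms of `RVec`. [cite: John1982, Ch. 5 §3] -/
def akOp (k : Fin 3) (x : E4) : RVec →L[ℝ] RVec := toOp (B.akMat k x)

/-- `B` as a field of endomorphisms of `RVec`. [cite: John1982, Ch. 5 §3] -/
def bOp (x : E4) : RVec →L[ℝ] RVec := toOp (B.bMat x)

/-- **`𝔄ᵏ = S⁻¹ Aᵏ S⁻¹`**, the (symmetric) coefficient of `∂_k` of the symmetrised system.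
[cite: Friedrichs1954, §1] -/
def frakAOp (k : Fin 3) (x : E4) : RVec →L[ℝ] RVec := B.sInvOp x * B.akOp k x * B.sInvOp x

/-- **`𝔅 = S⁻¹ B S⁻¹ − S (∂_t S⁻¹) − ∑_k 𝔄ᵏ (∂_k S) S⁻¹`**, the order-zero coefficient of the
symmetrised system (chosen so that `W = S V` solves `∂_t W = 𝔄ᵏ ∂_k W + 𝔅 W` exactly when `V`
solves `A⁰ ∂_t V = Aᵏ ∂_k V + B V`, by the product rule and `S S⁻¹ = 1` alone).
[cite: Friedrichs1954, §1] -/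
def frakBOp (x : E4) : RVec →L[ℝ] RVec :=
  B.sInvOp x * B.bOp x * B.sInvOp x - B.sOp x * fderiv ℝ B.sInvOp x (E4.basisVector 0) -
    ∑ k : Fin 3, B.frakAOp k x * fderiv ℝ B.sOp x (E4.basisVector k.succ) * B.sInvOp x

/-! ### Smoothness -/

/-- A `2 × 2` matrix of functions is entrywise smooth when its four entries are. [folklore] -/
theorem contDiff_fin_two_entries {p q r s : E4 → ℝ} (hp : ContDiff ℝ ∞ p) (hq : ContDiff ℝ ∞ q)
    (hr : ContDiff ℝ ∞ r) (hs : ContDiff ℝ ∞ s) (i j : Fin 2) :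
    ContDiff ℝ ∞ fun x ↦ !![p x, q x; r x, s x] i j := by
  fin_cases i <;> fin_cases j <;> simpa

/-- The entries of `S` are smooth. [cite: John1982, Ch. 5 §3] -/
theorem contDiff_sMat_entry (I J : RIdx) : ContDiff ℝ ∞ fun x ↦ B.sMat x I J := by
  rcases I with i | i <;> rcases J with j | j
  · simpa [sMat] using B.contDiff_sliceSqrt i j
  · simpa [sMat] using contDiff_const (c := (0 : ℝ))
  · simpa [sMat] using contDiff_const (c := (0 : ℝ))
  · simpa [sMat] using contDiff_fin_two_entries B.contDiff_invLapse contDiff_const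
      contDiff_const contDiff_const i j

/-- The entries of `S⁻¹` are smooth. [cite: John1982, Ch. 5 §3] -/
theorem contDiff_sInvMat_entry (I J : RIdx) : ContDiff ℝ ∞ fun x ↦ B.sInvMat x I J := by
  rcases I with i | i <;> rcases J with j | j
  · simpa [sInvMat] using B.contDiff_sliceSqrtInv i j
  · simpa [sInvMat] using contDiff_const (c := (0 : ℝ))
  · simpa [sInvMat] using contDiff_const (c := (0 : ℝ))
  · simpa [sInvMat] using contDiff_fin_two_entries B.contDiff_inv_invLapse contDiff_const
      contDiff_const contDiff_const i j

/-- The entries of `Aᵏ` are smooth. [cite: John1982, Ch. 5 §3] -/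
theorem contDiff_akMat_entry (k : Fin 3) (I J : RIdx) : ContDiff ℝ ∞ fun x ↦ B.akMat k x I J := by
  rcases I with i | i <;> rcases J with j | j
  · simpa [akMat] using (B.contDiff_shift k).mul (B.contDiff_sliceInvMetric i j)
  · by_cases hj : j = 0
    · simpa [akMat, hj] using B.contDiff_sliceInvMetric i k
    · simpa [akMat, hj] using contDiff_const (c := (0 : ℝ))
  · by_cases hi : i = 0
    · simpa [akMat, hi] using B.contDiff_sliceInvMetric k j
    · simpa [akMat, hi] using contDiff_const (c := (0 : ℝ))
  · simpa [akMat] using contDiff_fin_two_entries (B.contDiff_invLapseSq.mul (B.contDiff_shift k))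
      contDiff_const contDiff_const contDiff_const i j

/-- The entries of `B` are smooth. [cite: John1982, Ch. 5 §3] -/
theorem contDiff_bMat_entry (I J : RIdx) : ContDiff ℝ ∞ fun x ↦ B.bMat x I J := by
  rcases I with i | i <;> rcases J with j | j
  · simpa [bMat] using
      ContDiff.sum fun m _ ↦ (B.contDiff_sliceInvMetric i m).mul (B.contDiff_dShift m j)
  · simpa [bMat] using contDiff_const (c := (0 : ℝ))
  · by_cases hi : i = 0
    · simpa [bMat, hi] using B.contDiff_lowCoeff j
    · simpa [bMat, hi] using B.contDiff_shift j
  · simpa [bMat] using contDiff_fin_two_entries (B.contDiff_divInvMetric 0) contDiff_const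
      contDiff_const contDiff_const i j

/-- `S` is a smooth operator field. [cite: John1982, Ch. 5 §3] -/
theorem contDiff_sOp : ContDiff ℝ ∞ B.sOp := MatrixField.contDiff_toEuclideanCLM B.contDiff_sMat_entry

/-- `S⁻¹` is a smooth operator field. [cite: John1982, Ch. 5 §3] -/
theorem contDiff_sInvOp : ContDiff ℝ ∞ B.sInvOp :=
  MatrixField.contDiff_toEuclideanCLM B.contDiff_sInvMat_entry

/-- `Aᵏ` is a smooth operator field. [cite: John1982, Ch. 5 §3] -/
theorem contDiff_akOp (k : Fin 3) : ContDiff ℝ ∞ (B.akOp k) :=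
  MatrixField.contDiff_toEuclideanCLM (B.contDiff_akMat_entry k)

/-- `B` is a smooth operator field. [cite: John1982, Ch. 5 §3] -/
theorem contDiff_bOp : ContDiff ℝ ∞ B.bOp := MatrixField.contDiff_toEuclideanCLM B.contDiff_bMat_entry

/-- `𝔄ᵏ` is a smooth operator field. [cite: Friedrichs1954, §1] -/
theorem contDiff_frakAOp (k : Fin 3) : ContDiff ℝ ∞ (B.frakAOp k) :=
  (B.contDiff_sInvOp.mul (B.contDiff_akOp k)).mul B.contDiff_sInvOp

/-- `x ↦ ∂_v S (x)` is a smooth operator field. [folklore] -/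
theorem contDiff_fderiv_sOp_apply (v : E4) : ContDiff ℝ ∞ fun x ↦ fderiv ℝ B.sOp x v :=
  (B.contDiff_sOp.fderiv_right (m := ∞) le_rfl).clm_apply contDiff_const

/-- `x ↦ ∂_v S⁻¹ (x)` is a smooth operator field. [folklore] -/
theorem contDiff_fderiv_sInvOp_apply (v : E4) : ContDiff ℝ ∞ fun x ↦ fderiv ℝ B.sInvOp x v :=
  (B.contDiff_sInvOp.fderiv_right (m := ∞) le_rfl).clm_apply contDiff_const

/-- `𝔅` is a smooth operator field. [cite: Friedrichs1954, §1] -/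
theorem contDiff_frakBOp : ContDiff ℝ ∞ B.frakBOp :=
  (((B.contDiff_sInvOp.mul B.contDiff_bOp).mul B.contDiff_sInvOp).sub
    (B.contDiff_sOp.mul (B.contDiff_fderiv_sInvOp_apply _))).sub
    (ContDiff.sum fun k _ ↦
      ((B.contDiff_frakAOp k).mul (B.contDiff_fderiv_sOp_apply _)).mul B.contDiff_sInvOp)

/-! ### The algebra `S S⁻¹ = S⁻¹ S = 1`, `S S = A⁰` -/

/-- `S (S⁻¹ w) = w`. [cite: John1982, Ch. 5 §3] -/
theorem sOp_sInvOp_apply (x : E4) (w : RVec) : B.sOp x (B.sInvOp x w) = w := by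
  rw [sOp, sInvOp, ← MatrixField.toEuclideanCLM_mul_apply, B.sMat_mul_sInvMat,
    MatrixField.toEuclideanCLM_one_apply]

/-- `S⁻¹ (S w) = w`. [cite: John1982, Ch. 5 §3] -/
theorem sInvOp_sOp_apply (x : E4) (w : RVec) : B.sInvOp x (B.sOp x w) = w := by
  rw [sOp, sInvOp, ← MatrixField.toEuclideanCLM_mul_apply, B.sInvMat_mul_sMat,
    MatrixField.toEuclideanCLM_one_apply]

/-- `S (S w) = A⁰ w`. [cite: John1982, Ch. 5 §3] -/
theorem sOp_sOp_apply (x : E4) (w : RVec) : B.sOp x (B.sOp x w) = B.a0Op x w := by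
  rw [sOp, a0Op, ← MatrixField.toEuclideanCLM_mul_apply, B.sMat_mul_sMat]

/-! ### Symmetry of the principal coefficients -/

/-- `S⁻¹` is symmetric for the Euclidean inner product. [cite: John1982, Ch. 5 §3] -/
theorem inner_sInvOp_comm (x : E4) (u w : RVec) : ⟪B.sInvOp x u, w⟫ = ⟪u, B.sInvOp x w⟫ :=
  MatrixField.inner_toEuclideanCLM_comm (B.isSymm_sInvMat x) u w

/-- `Aᵏ` is symmetric for the Euclidean inner product. [cite: John1982, Ch. 5 §3] -/
theorem inner_akOp_comm (k : Fin 3) (x : E4) (u w : RVec) :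
    ⟪B.akOp k x u, w⟫ = ⟪u, B.akOp k x w⟫ :=
  MatrixField.inner_toEuclideanCLM_comm (B.isSymm_akMat k x) u w

/-- **`𝔄ᵏ = S⁻¹ Aᵏ S⁻¹` is symmetric for the Euclidean inner product** — the hypothesis `symm` of
the tree's `Literature.Analysis.PDE.IsSymmCoeff`. [cite: Friedrichs1954, §1] -/
theorem inner_frakAOp_comm (k : Fin 3) (x : E4) (u w : RVec) :
    ⟪B.frakAOp k x u, w⟫ = ⟪u, B.frakAOp k x w⟫ := by
  simp only [frakAOp, mul_apply_eq_comp]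
  rw [B.inner_sInvOp_comm, B.inner_akOp_comm, B.inner_sInvOp_comm]

/-! ### Components -/

/-- The spatial components of `S⁻¹ w`: `(S⁻¹ w)_i = ∑_j E⁻¹_{ij} w_j`. [cite: John1982, Ch. 5 §3] -/
theorem sInvOp_apply_inl (x : E4) (w : RVec) (i : Fin 3) :
    B.sInvOp x w (Sum.inl i) = ∑ j, B.sliceSqrtInv x i j * w (Sum.inl j) := by
  rw [sInvOp, MatrixField.toEuclideanCLM_apply_coord, Fintype.sum_sum_type]
  simp [sInvMat, Matrix.fromBlocks_apply₁₁, Matrix.fromBlocks_apply₁₂]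

/-- The `q₀`-component of `S⁻¹ w`: `(S⁻¹ w)₀ = w₀/√a`. [cite: John1982, Ch. 5 §3] -/
theorem sInvOp_apply_inr_zero (x : E4) (w : RVec) :
    B.sInvOp x w (Sum.inr 0) = (B.invLapse x)⁻¹ * w (Sum.inr 0) := by
  rw [sInvOp, MatrixField.toEuclideanCLM_apply_coord, Fintype.sum_sum_type]
  simp [sInvMat, Matrix.fromBlocks_apply₂₁, Matrix.fromBlocks_apply₂₂, Fin.sum_univ_two]

/-- The `u`-component of `S⁻¹ w`: `(S⁻¹ w)_u = w_u`. [cite: John1982, Ch. 5 §3] -/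
theorem sInvOp_apply_inr_one (x : E4) (w : RVec) :
    B.sInvOp x w (Sum.inr 1) = w (Sum.inr 1) := by
  rw [sInvOp, MatrixField.toEuclideanCLM_apply_coord, Fintype.sum_sum_type]
  simp [sInvMat, Matrix.fromBlocks_apply₂₁, Matrix.fromBlocks_apply₂₂, Fin.sum_univ_two]

/-- The spatial components of `S w`: `(S w)_i = ∑_j E_{ij} w_j`. [cite: John1982, Ch. 5 §3] -/
theorem sOp_apply_inl (x : E4) (w : RVec) (i : Fin 3) :
    B.sOp x w (Sum.inl i) = ∑ j, B.sliceSqrt x i j * w (Sum.inl j) := by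
  rw [sOp, MatrixField.toEuclideanCLM_apply_coord, Fintype.sum_sum_type]
  simp [sMat, Matrix.fromBlocks_apply₁₁, Matrix.fromBlocks_apply₁₂]

/-- The `q₀`-component of `S w`: `(S w)₀ = √a w₀`. [cite: John1982, Ch. 5 §3] -/
theorem sOp_apply_inr_zero (x : E4) (w : RVec) :
    B.sOp x w (Sum.inr 0) = B.invLapse x * w (Sum.inr 0) := by
  rw [sOp, MatrixField.toEuclideanCLM_apply_coord, Fintype.sum_sum_type]
  simp [sMat, Matrix.fromBlocks_apply₂₁, Matrix.fromBlocks_apply₂₂, Fin.sum_univ_two]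

/-- The `u`-component of `S w`: `(S w)_u = w_u`. [cite: John1982, Ch. 5 §3] -/
theorem sOp_apply_inr_one (x : E4) (w : RVec) : B.sOp x w (Sum.inr 1) = w (Sum.inr 1) := by
  rw [sOp, MatrixField.toEuclideanCLM_apply_coord, Fintype.sum_sum_type]
  simp [sMat, Matrix.fromBlocks_apply₂₁, Matrix.fromBlocks_apply₂₂, Fin.sum_univ_two]

/-- The spatial components of `A⁰ w`: `∑_j h_{ij} w_j`. [cite: John1982, Ch. 5 §3] -/
theorem a0Op_apply_inl (x : E4) (w : RVec) (i : Fin 3) :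
    B.a0Op x w (Sum.inl i) = ∑ j, B.sliceInvMetric x i j * w (Sum.inl j) := by
  rw [a0Op, MatrixField.toEuclideanCLM_apply_coord, Fintype.sum_sum_type]
  simp [a0Mat, Matrix.fromBlocks_apply₁₁, Matrix.fromBlocks_apply₁₂]

/-- The `q₀`-component of `A⁰ w`: `a w₀`. [cite: John1982, Ch. 5 §3] -/
theorem a0Op_apply_inr_zero (x : E4) (w : RVec) :
    B.a0Op x w (Sum.inr 0) = B.invLapseSq x * w (Sum.inr 0) := by
  rw [a0Op, MatrixField.toEuclideanCLM_apply_coord, Fintype.sum_sum_type]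
  simp [a0Mat, Matrix.fromBlocks_apply₂₁, Matrix.fromBlocks_apply₂₂, Fin.sum_univ_two]

/-- The `u`-component of `A⁰ w`: `w_u`. [cite: John1982, Ch. 5 §3] -/
theorem a0Op_apply_inr_one (x : E4) (w : RVec) : B.a0Op x w (Sum.inr 1) = w (Sum.inr 1) := by
  rw [a0Op, MatrixField.toEuclideanCLM_apply_coord, Fintype.sum_sum_type]
  simp [a0Mat, Matrix.fromBlocks_apply₂₁, Matrix.fromBlocks_apply₂₂, Fin.sum_univ_two]

/-- The spatial components of `Aᵏ w`: `βᵏ ∑_j h_{ij} w_j + h_{ik} w₀`. [cite: John1982, Ch. 5 §3] -/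
theorem akOp_apply_inl (k : Fin 3) (x : E4) (w : RVec) (i : Fin 3) :
    B.akOp k x w (Sum.inl i) =
      B.shift x k * ∑ j, B.sliceInvMetric x i j * w (Sum.inl j) +
        B.sliceInvMetric x i k * w (Sum.inr 0) := by
  rw [akOp, MatrixField.toEuclideanCLM_apply_coord, Fintype.sum_sum_type]
  simp [akMat, Matrix.fromBlocks_apply₁₁, Matrix.fromBlocks_apply₁₂, Finset.mul_sum, mul_assoc]

/-- The `q₀`-component of `Aᵏ w`: `∑_j h_{kj} w_j + a βᵏ w₀`. [cite: John1982, Ch. 5 §3] -/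
theorem akOp_apply_inr_zero (k : Fin 3) (x : E4) (w : RVec) :
    B.akOp k x w (Sum.inr 0) =
      ∑ j, B.sliceInvMetric x k j * w (Sum.inl j) + B.invLapseSq x * B.shift x k * w (Sum.inr 0) := by
  rw [akOp, MatrixField.toEuclideanCLM_apply_coord, Fintype.sum_sum_type]
  simp [akMat, Matrix.fromBlocks_apply₂₁, Matrix.fromBlocks_apply₂₂, Fin.sum_univ_two]

/-- The `u`-component of `Aᵏ w` vanishes. [cite: John1982, Ch. 5 §3] -/
theorem akOp_apply_inr_one (k : Fin 3) (x : E4) (w : RVec) : B.akOp k x w (Sum.inr 1) = 0 := by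
  rw [akOp, MatrixField.toEuclideanCLM_apply_coord, Fintype.sum_sum_type]
  simp [akMat, Matrix.fromBlocks_apply₂₁, Matrix.fromBlocks_apply₂₂, Fin.sum_univ_two]

/-- The spatial components of `B w`: `∑_m (∑_j h_{ij} ∂_jβᵐ) w_m`. [cite: John1982, Ch. 5 §3] -/
theorem bOp_apply_inl (x : E4) (w : RVec) (i : Fin 3) :
    B.bOp x w (Sum.inl i) = ∑ m, (∑ j, B.sliceInvMetric x i j * B.dShift x j m) * w (Sum.inl m) := by
  rw [bOp, MatrixField.toEuclideanCLM_apply_coord, Fintype.sum_sum_type]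
  simp [bMat, Matrix.fromBlocks_apply₁₁, Matrix.fromBlocks_apply₁₂]

/-- The `q₀`-component of `B w`: `∑_j eʲ w_j + e⁰ w₀`. [cite: John1982, Ch. 5 §3] -/
theorem bOp_apply_inr_zero (x : E4) (w : RVec) :
    B.bOp x w (Sum.inr 0) = ∑ j, B.lowCoeff x j * w (Sum.inl j) + B.divInvMetric x 0 * w (Sum.inr 0) := by
  rw [bOp, MatrixField.toEuclideanCLM_apply_coord, Fintype.sum_sum_type]
  simp [bMat, Matrix.fromBlocks_apply₂₁, Matrix.fromBlocks_apply₂₂, Fin.sum_univ_two]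

/-- The `u`-component of `B w`: `∑_j βʲ w_j + w₀`. [cite: John1982, Ch. 5 §3] -/
theorem bOp_apply_inr_one (x : E4) (w : RVec) :
    B.bOp x w (Sum.inr 1) = ∑ j, B.shift x j * w (Sum.inl j) + w (Sum.inr 0) := by
  rw [bOp, MatrixField.toEuclideanCLM_apply_coord, Fintype.sum_sum_type]
  simp [bMat, Matrix.fromBlocks_apply₂₁, Matrix.fromBlocks_apply₂₂, Fin.sum_univ_two]

/-! ### The flat region -/

/-- The constant coefficient `Aᵏ_η` of the Minkowski background (`a = 1`, `β = 0`, `h = δ`): the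
couplings `δ_{ik}` between `q_i` and `q₀` only. [cite: John1982, Ch. 5 §3] -/
def akFlat (k : Fin 3) : Matrix RIdx RIdx ℝ :=
  Matrix.fromBlocks 0 (Matrix.of fun i r ↦ if r = 0 then (if i = k then 1 else 0) else 0)
    (Matrix.of fun r j ↦ if r = 0 then (if k = j then 1 else 0) else 0) 0

/-- The constant coefficient `B_η` of the Minkowski background: only the entry `1` of
`∂_t u = q₀`. [cite: John1982, Ch. 5 §3] -/
def bFlat : Matrix RIdx RIdx ℝ := Matrix.fromBlocks 0 0 0 !![0, 0; 1, 0]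

/-- Where `φ = 0`: `S = 1`. [cite: John1982, Ch. 5 §3] -/
theorem sMat_of_eq_zero {x : E4} (hx : B.φ x = 0) : B.sMat x = 1 := by
  have hE : B.eMat x = 1 := Matrix.ext fun j k ↦ by
    rw [eMat_apply, B.sliceSqrt_of_eq_zero hx, Matrix.one_apply]
  rw [sMat, hE, B.invLapse_of_eq_zero hx, ← Matrix.one_fin_two, Matrix.fromBlocks_one]

/-- Where `φ = 0`: `S⁻¹ = 1`. [cite: John1982, Ch. 5 §3] -/
theorem sInvMat_of_eq_zero {x : E4} (hx : B.φ x = 0) : B.sInvMat x = 1 := by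
  have hE : B.eInvMat x = 1 := Matrix.ext fun j k ↦ by
    rw [eInvMat_apply, B.sliceSqrtInv_of_eq_zero hx, Matrix.one_apply]
  rw [sInvMat, hE, B.invLapse_of_eq_zero hx, inv_one, ← Matrix.one_fin_two, Matrix.fromBlocks_one]

/-- Where `φ = 0`: `a = 1`. [cite: ChoquetbruhatCotsakis2002, §2 (2.2)] -/
theorem invLapseSq_of_eq_zero {x : E4} (hx : B.φ x = 0) : B.invLapseSq x = 1 := by
  rw [invLapseSq_apply, hx, add_zero]

/-- Where `φ = 0`: `h = δ`. [cite: ChoquetbruhatCotsakis2002, §2 (2.1)] -/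
theorem sliceInvMetric_of_eq_zero {x : E4} (hx : B.φ x = 0) (j k : Fin 3) :
    B.sliceInvMetric x j k = if j = k then 1 else 0 := by
  rw [B.sliceInvMetric_eq, hx]; ring

/-- Where `φ = 0`: `Aᵏ = Aᵏ_η`. [cite: John1982, Ch. 5 §3] -/
theorem akMat_of_eq_zero {x : E4} (hx : B.φ x = 0) (k : Fin 3) : B.akMat k x = akFlat k := by
  have hh : B.hMat x = 1 := Matrix.ext fun j l ↦ by
    rw [hMat_apply, B.sliceInvMetric_of_eq_zero hx, Matrix.one_apply]
  rw [akMat, akFlat, hh, B.shift_eq_zero_of_eq_zero hx, zero_smul]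
  congr 1
  · ext i r; simp [B.sliceInvMetric_of_eq_zero hx]
  · ext r j; simp [B.sliceInvMetric_of_eq_zero hx]
  · rw [B.invLapseSq_of_eq_zero hx]; norm_num
    ext i j; fin_cases i <;> fin_cases j <;> rfl

/-- If `φ` vanishes near `x`, every derivative of a function of `x` through `φ`-flat quantities
vanishes: here, the shift has vanishing derivative. [cite: ChoquetbruhatCotsakis2002, §2 (2.1)] -/
theorem fderiv_shift_of_eventuallyEq {x : E4} (hx : ∀ᶠ y in 𝓝 x, B.φ y = 0) (m : Fin 3) :
    fderiv ℝ (fun y ↦ B.shift y m) x = 0 := by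
  have h : (fun y ↦ B.shift y m) =ᶠ[𝓝 x] fun _ ↦ (0 : ℝ) := by
    filter_upwards [hx] with y hy using B.shift_eq_zero_of_eq_zero hy m
  rw [h.fderiv_eq, fderiv_const_apply]

/-- If `φ` vanishes near `x`, the inverse metric has vanishing derivative at `x`.
[cite: KerrSchild1965, §2] -/
theorem fderiv_inverseMetric_of_eventuallyEq {x : E4} (hx : ∀ᶠ y in 𝓝 x, B.φ y = 0) (μ ν : Fin 4) :
    fderiv ℝ (fun y ↦ B.inverseMetric y μ ν) x = 0 := by
  have h : (fun y ↦ B.inverseMetric y μ ν) =ᶠ[𝓝 x] fun _ ↦ Kerr.etaComp μ ν := by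
    filter_upwards [hx] with y hy using inverseMetric_of_eq_zero B.l hy μ ν
  rw [h.fderiv_eq, fderiv_const_apply]

/-- Where `φ` vanishes near `x`: `B = B_η`. [cite: John1982, Ch. 5 §3] -/
theorem bMat_of_eventuallyEq {x : E4} (hx : ∀ᶠ y in 𝓝 x, B.φ y = 0) : B.bMat x = bFlat := by
  have hx0 : B.φ x = 0 := hx.self_of_nhds
  have hdS : ∀ j m, B.dShift x j m = 0 := fun j m ↦ by
    rw [dShift, B.fderiv_shift_of_eventuallyEq hx]; rfl
  have hdt : ∀ m, B.dtShift x m = 0 := fun m ↦ by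
    rw [dtShift, B.fderiv_shift_of_eventuallyEq hx]; rfl
  have hdiv : ∀ ν, B.divInvMetric x ν = 0 := fun ν ↦ by
    unfold divInvMetric
    exact Finset.sum_eq_zero fun μ _ ↦ by rw [B.fderiv_inverseMetric_of_eventuallyEq hx]; rfl
  have hlow : ∀ k, B.lowCoeff x k = 0 := fun k ↦ by
    simp [lowCoeff, hdiv, hdt, hdS]
  rw [bMat, bFlat]
  congr 1
  · ext i m; simp [hdS]
  · ext r j
    fin_cases r
    · simp [hlow]
    · simp [B.shift_eq_zero_of_eq_zero hx0]
  · rw [hdiv]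

/-- Where `φ` vanishes near `x`: `S` has vanishing derivative at `x`. [cite: John1982, Ch. 5 §3] -/
theorem fderiv_sOp_of_eventuallyEq {x : E4} (hx : ∀ᶠ y in 𝓝 x, B.φ y = 0) : fderiv ℝ B.sOp x = 0 := by
  have h : B.sOp =ᶠ[𝓝 x] fun _ ↦ toOp (1 : Matrix RIdx RIdx ℝ) := by
    filter_upwards [hx] with y hy
    rw [sOp, B.sMat_of_eq_zero hy]
  rw [h.fderiv_eq, fderiv_const_apply]

/-- Where `φ` vanishes near `x`: `S⁻¹` has vanishing derivative at `x`. [cite: John1982, Ch. 5 §3] -/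
theorem fderiv_sInvOp_of_eventuallyEq {x : E4} (hx : ∀ᶠ y in 𝓝 x, B.φ y = 0) :
    fderiv ℝ B.sInvOp x = 0 := by
  have h : B.sInvOp =ᶠ[𝓝 x] fun _ ↦ toOp (1 : Matrix RIdx RIdx ℝ) := by
    filter_upwards [hx] with y hy
    rw [sInvOp, B.sInvMat_of_eq_zero hy]
  rw [h.fderiv_eq, fderiv_const_apply]

/-- **Where `φ` vanishes near `x`, `𝔄ᵏ(x)` is the constant Minkowski coefficient `Aᵏ_η`.**
[cite: Friedrichs1954, §1] -/
theorem frakAOp_of_eventuallyEq {x : E4} (hx : ∀ᶠ y in 𝓝 x, B.φ y = 0) (k : Fin 3) :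
    B.frakAOp k x = toOp (akFlat k) := by
  have hx0 : B.φ x = 0 := hx.self_of_nhds
  have h1 : B.sInvOp x = 1 := by rw [sInvOp, B.sInvMat_of_eq_zero hx0, map_one]
  rw [frakAOp, h1, one_mul, mul_one, akOp, B.akMat_of_eq_zero hx0]

/-- **Where `φ` vanishes near `x`, `𝔅(x)` is the constant Minkowski coefficient `B_η`.**
[cite: Friedrichs1954, §1] -/
theorem frakBOp_of_eventuallyEq {x : E4} (hx : ∀ᶠ y in 𝓝 x, B.φ y = 0) :
    B.frakBOp x = toOp bFlat := by
  have hx0 : B.φ x = 0 := hx.self_of_nhds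
  have h1 : B.sInvOp x = 1 := by rw [sInvOp, B.sInvMat_of_eq_zero hx0, map_one]
  rw [frakBOp, h1, one_mul, mul_one, bOp, B.bMat_of_eventuallyEq hx, B.fderiv_sInvOp_of_eventuallyEq hx,
    B.fderiv_sOp_of_eventuallyEq hx]
  simp

end Background

end KerrSchild

end Literature.Geometry.Lorentzian

end
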